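import Summits.QuantumFields.YangMills.Theorems.AllWindowsColdBoxBoxHighLineTiltParity
import Summits.QuantumFields.YangMills.Theorems.AllWindowsColdBoxBoxHighLineTiltCumulantBounds
import Summits.QuantumFields.YangMills.Theorems.AllWindowsColdBoxBoxHighLineChartGaussianTail

/-!
# T-S5.13 (e4) skeleton — the PARITY SPLIT of the third cumulant `f′(0) = κ₃,₀(G₁,G₂,U) = E_0[G̃₁G̃₂Ũ]` on `μ_D`

Planner ym-idea-2 g18's `ASSEMBLY-S5.md` §6 (e4): «`f′(0) = E_D[c̃₀c̃_TŨ] = E_D[c̃₀^{ev}c̃_T^{ev}Ũ_{even}] + E_D[c₀^{odd}c_T^{odd}·(−V₃)] + …`, odd × even × even = 0 by parity».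
Over `μ_D := (volume.restrict (smallField H s)).withDensity (ofReal ∘ gaussWeight β H)`, for observables split into even + odd parts which are measurable and BOUNDED ON
`smallField H s` (as are the chart costs and, by ✓13s, the tilt exponent), this file proves the exact identity

  `κ₃,₀(E₁+O₁, E₂+O₂, U_e+U_o) = E_0[Ẽ₁Ẽ₂Ũ_e] + E_0[Ẽ₁·O₂·U_o] + E_0[O₁·Ẽ₂·U_o] + E_0[O₁·O₂·Ũ_e]`   (★`tiltCum3_muD_zero_parity_split`)

(`Ẽ = E − E_0[E]`, `Ũ_e = U_e − E_0[U_e]`; the other four of the eight terms vanish by ✓`…TiltParity`), after the `μ_D`-linearity of `E_0` in `gaussAvg` letters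
(`tiltExp_muD_zero_add`, `…_sum4`, via ✓`Tilt.tiltExp_muD_zero_eq`) for observables bounded on `D` (`integrable_sfInd_mul`).  The sizes of the four survivors are then
Hölder/Cauchy–Schwarz (✓`Tilt.abs_tiltExp_mul_mul_le`) against ✓12a/✓12d/13K-U/✓13s — not in this file.

Tree (✓TiltParity, ✓TiltCumulantBounds) + Mathlib; no definitions.  HONEST LABEL: bookkeeping for the T-S5.13 assembly of the XL stub S5 of a critic-PASSed DRAFT line; T-S5.13/S5,
U5, ⟨24004⟩ ⟨24335⟩ ⟨24336⟩ remain OPEN; route AllWindowsColdBox is DRAFT; no rung is proved; the Yang–Mills mass gap is NOT proved by this file.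
Seat ym-line-sfw-p2 g77 (LEAD, cell ym-idea-1; T-S5.13 assembler of record).
-/

set_option autoImplicit false

noncomputable section

open MeasureTheory Set
open scoped ENNReal

namespace Summit.QuantumFields.YangMills.Theorems.AllWindowsColdBoxBoxHighLine

namespace Tilt

variable (H : ℕ)

/-! ## Integrability of `sfInd·P` for `P` bounded on `D` -/

/-- The small-field indicator is measurable (w4's ✓`ChartGauss.measurableSet_smallField`). -/
theorem measurable_sfInd (s : ℝ) : Measurable (sfInd H s) := by
  unfold sfInd
  exact measurable_const.indicator (ChartGauss.measurableSet_smallField (H := H) s)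

/-- `|sfInd·P| ≤ B` everywhere when `|P| ≤ B` on the small-field set (`0 ≤ B`). -/
theorem abs_sfInd_mul_le {s : ℝ} {P : (LandauFree H → E3) → ℝ} {B : ℝ} (hB : 0 ≤ B) (hP : ∀ a ∈ smallField H s, |P a| ≤ B) (a : LandauFree H → E3) :
    |sfInd H s a * P a| ≤ B := by
  unfold sfInd
  by_cases ha : a ∈ smallField H s
  · rw [Set.indicator_of_mem ha, one_mul]; exact hP a ha
  · rw [Set.indicator_of_notMem ha, zero_mul, abs_zero]; exact hB

/-- `sfInd·P·gaussWeight` is integrable for `P` measurable and bounded on the small-field set. -/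
theorem integrable_sfInd_mul {β : ℝ} (hβ : 0 < β) (s : ℝ) {P : (LandauFree H → E3) → ℝ} {B : ℝ} (hPm : Measurable P) (hB : 0 ≤ B)
    (hP : ∀ a ∈ smallField H s, |P a| ≤ B) : Integrable fun a : LandauFree H → E3 => sfInd H s a * P a * gaussWeight β H a :=
  integrable_bdd_mul_gaussWeight H hβ ((measurable_sfInd H s).mul hPm) (abs_sfInd_mul_le H hB hP)

/-! ## Linearity of `E_0` over `μ_D` for observables bounded on `D` -/

/-- `E_0[F + G] = E_0[F] + E_0[G]` on `μ_D` for measurable `F`, `G` bounded on the small-field set. -/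
theorem tiltExp_muD_zero_add {β : ℝ} (hβ : 0 < β) (s : ℝ) (U : (LandauFree H → E3) → ℝ) {F G : (LandauFree H → E3) → ℝ} {B : ℝ} (hB : 0 ≤ B)
    (hFm : Measurable F) (hGm : Measurable G) (hF : ∀ a ∈ smallField H s, |F a| ≤ B) (hG : ∀ a ∈ smallField H s, |G a| ≤ B) :
    tiltExp ((volume.restrict (smallField H s)).withDensity fun a => ENNReal.ofReal (gaussWeight β H a)) U 0 (fun a => F a + G a) =
      tiltExp ((volume.restrict (smallField H s)).withDensity fun a => ENNReal.ofReal (gaussWeight β H a)) U 0 F +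
        tiltExp ((volume.restrict (smallField H s)).withDensity fun a => ENNReal.ofReal (gaussWeight β H a)) U 0 G := by
  rw [tiltExp_muD_zero_eq H hβ, tiltExp_muD_zero_eq H hβ, tiltExp_muD_zero_eq H hβ, ← add_div]
  congr 1
  rw [← EdgeChartGaussian.gaussAvg_add _ _ (integrable_sfInd_mul H hβ s hFm hB hF) (integrable_sfInd_mul H hβ s hGm hB hG)]
  exact congrArg _ (funext fun a => by ring)

/-- `E_0[c] = c` on `μ_D` (given `D` has positive Gaussian mass). -/
theorem tiltExp_muD_zero_const {β : ℝ} (hβ : 0 < β) (s : ℝ) (U : (LandauFree H → E3) → ℝ) (hD : 0 < ∫ a, sfInd H s a * gaussWeight β H a) (c : ℝ) :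
    tiltExp ((volume.restrict (smallField H s)).withDensity fun a => ENNReal.ofReal (gaussWeight β H a)) U 0 (fun _ => c) = c := by
  rw [tiltExp_muD_zero_eq H hβ]
  have hZ := EdgeChartGaussian.integral_gaussWeight_pos H hβ
  have hne : gaussAvg β H (sfInd H s) ≠ 0 := by
    unfold gaussAvg; exact (div_pos hD hZ).ne'
  have h : gaussAvg β H (fun a => sfInd H s a * c) = c * gaussAvg β H (sfInd H s) := by
    rw [← EdgeChartGaussian.gaussAvg_const_mul]
    exact congrArg _ (funext fun a => by ring)
  rw [h, mul_div_assoc, div_self hne, mul_one]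

/-! ## The parity split of `κ₃,₀` -/

/-- ★ **Parity split of the third cumulant at `t = 0` on `μ_D`** (ASSEMBLY-S5 §6 (e4)).  For measurable `E₁, O₁, E₂, O₂, U_e, U_o` bounded by `B` on `smallField H s`,
`E₁, E₂, U_e` even and `O₁, O₂, U_o` odd, and `D` of positive Gaussian mass:
`κ₃,₀(E₁+O₁, E₂+O₂, U_e+U_o) = E_0[Ẽ₁Ẽ₂Ũ_e] + E_0[Ẽ₁·O₂·U_o] + E_0[O₁·Ẽ₂·U_o] + E_0[O₁·O₂·Ũ_e]` with `Ẽ_i = E_i − E_0[E_i]`, `Ũ_e = U_e − E_0[U_e]`. -/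
theorem tiltCum3_muD_zero_parity_split {β : ℝ} (hβ : 0 < β) (s : ℝ) (hD : 0 < ∫ a, sfInd H s a * gaussWeight β H a)
    {E₁ O₁ E₂ O₂ Ue Uo : (LandauFree H → E3) → ℝ} {B : ℝ} (hB : 0 ≤ B)
    (mE₁ : Measurable E₁) (mO₁ : Measurable O₁) (mE₂ : Measurable E₂) (mO₂ : Measurable O₂) (mUe : Measurable Ue) (mUo : Measurable Uo)
    (bE₁ : ∀ a ∈ smallField H s, |E₁ a| ≤ B) (bO₁ : ∀ a ∈ smallField H s, |O₁ a| ≤ B) (bE₂ : ∀ a ∈ smallField H s, |E₂ a| ≤ B)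
    (bO₂ : ∀ a ∈ smallField H s, |O₂ a| ≤ B) (bUe : ∀ a ∈ smallField H s, |Ue a| ≤ B) (bUo : ∀ a ∈ smallField H s, |Uo a| ≤ B)
    (pE₁ : ∀ a, E₁ (-a) = E₁ a) (pO₁ : ∀ a, O₁ (-a) = -O₁ a) (pE₂ : ∀ a, E₂ (-a) = E₂ a) (pO₂ : ∀ a, O₂ (-a) = -O₂ a)
    (pUe : ∀ a, Ue (-a) = Ue a) (pUo : ∀ a, Uo (-a) = -Uo a) :
    let μD : Measure (LandauFree H → E3) := (volume.restrict (smallField H s)).withDensity fun a => ENNReal.ofReal (gaussWeight β H a)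
    let U : (LandauFree H → E3) → ℝ := fun a => Ue a + Uo a
    tiltCum3 μD U 0 (fun a => E₁ a + O₁ a) (fun a => E₂ a + O₂ a) =
      tiltExp μD U 0 (fun a => (E₁ a - tiltExp μD U 0 E₁) * (E₂ a - tiltExp μD U 0 E₂) * (Ue a - tiltExp μD U 0 Ue)) +
      tiltExp μD U 0 (fun a => (E₁ a - tiltExp μD U 0 E₁) * O₂ a * Uo a) +
      tiltExp μD U 0 (fun a => O₁ a * (E₂ a - tiltExp μD U 0 E₂) * Uo a) +
      tiltExp μD U 0 (fun a => O₁ a * O₂ a * (Ue a - tiltExp μD U 0 Ue)) := by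
  intro μD U
  -- means: the odd parts have zero mean
  have hO₁ : tiltExp μD U 0 O₁ = 0 := tiltExp_muD_zero_eq_zero_of_odd H hβ s U pO₁
  have hO₂ : tiltExp μD U 0 O₂ = 0 := tiltExp_muD_zero_eq_zero_of_odd H hβ s U pO₂
  have hUo : tiltExp μD U 0 Uo = 0 := tiltExp_muD_zero_eq_zero_of_odd H hβ s U pUo
  have hG₁ : tiltExp μD U 0 (fun a => E₁ a + O₁ a) = tiltExp μD U 0 E₁ := by
    rw [show tiltExp μD U 0 (fun a => E₁ a + O₁ a) = tiltExp μD U 0 E₁ + tiltExp μD U 0 O₁ from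
      tiltExp_muD_zero_add H hβ s U hB mE₁ mO₁ bE₁ bO₁, hO₁, add_zero]
  have hG₂ : tiltExp μD U 0 (fun a => E₂ a + O₂ a) = tiltExp μD U 0 E₂ := by
    rw [show tiltExp μD U 0 (fun a => E₂ a + O₂ a) = tiltExp μD U 0 E₂ + tiltExp μD U 0 O₂ from
      tiltExp_muD_zero_add H hβ s U hB mE₂ mO₂ bE₂ bO₂, hO₂, add_zero]
  have hU : tiltExp μD U 0 U = tiltExp μD U 0 Ue := by
    rw [show tiltExp μD U 0 U = tiltExp μD U 0 Ue + tiltExp μD U 0 Uo from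
      tiltExp_muD_zero_add H hβ s U hB mUe mUo bUe bUo, hUo, add_zero]
  -- abbreviations for the centred even parts
  set m₁ := tiltExp μD U 0 E₁ with hm₁
  set m₂ := tiltExp μD U 0 E₂ with hm₂
  set mu := tiltExp μD U 0 Ue with hmu
  -- the means are bounded by B (so centred parts are bounded by 2B on D)
  have mean_le : ∀ {F : (LandauFree H → E3) → ℝ}, Measurable F → (∀ a ∈ smallField H s, |F a| ≤ B) → |tiltExp μD U 0 F| ≤ B := by
    intro F hFm hF
    rw [show tiltExp μD U 0 F = tiltExp μD U 0 F from rfl, tiltExp_muD_zero_eq H hβ]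
    have hZ := EdgeChartGaussian.integral_gaussWeight_pos H hβ
    have hpos : 0 < gaussAvg β H (sfInd H s) := by unfold gaussAvg; exact div_pos hD hZ
    rw [abs_div, abs_of_pos hpos, div_le_iff₀ hpos]
    have h1 : |gaussAvg β H (fun a => sfInd H s a * F a)| ≤ gaussAvg β H (fun a => |sfInd H s a * F a|) := by
      unfold gaussAvg
      rw [abs_div, abs_of_pos hZ]
      refine div_le_div_of_nonneg_right ?_ hZ.le
      refine (abs_integral_le_integral_abs).trans (le_of_eq (integral_congr_ae (Filter.Eventually.of_forall fun a => ?_)))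
      simp only [abs_mul, abs_of_pos (EdgeChartGaussian.gaussWeight_pos β H a)]
    have h2 : gaussAvg β H (fun a => |sfInd H s a * F a|) ≤ gaussAvg β H (fun a => B * sfInd H s a) := by
      have hIb : Integrable fun a : LandauFree H → E3 => B * sfInd H s a * gaussWeight β H a := by
        refine integrable_bdd_mul_gaussWeight H hβ ((measurable_sfInd H s).const_mul B) (C := B) fun a => ?_
        unfold sfInd
        by_cases ha : a ∈ smallField H s
        · rw [Set.indicator_of_mem ha, mul_one, abs_of_nonneg hB]
        · rw [Set.indicator_of_notMem ha, mul_zero, abs_zero]; exact hB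
      refine EdgeChartGaussian.gaussAvg_mono_of_nonneg H hβ (fun a => abs_nonneg _) (fun a => ?_) hIb
      unfold sfInd
      by_cases ha : a ∈ smallField H s
      · rw [Set.indicator_of_mem ha, one_mul, mul_one]; exact hF a ha
      · rw [Set.indicator_of_notMem ha, zero_mul, abs_zero, mul_zero]
    rw [EdgeChartGaussian.gaussAvg_const_mul] at h2
    exact h1.trans h2
  have bm₁ : |m₁| ≤ B := mean_le mE₁ bE₁
  have bm₂ : |m₂| ≤ B := mean_le mE₂ bE₂
  have bmu : |mu| ≤ B := mean_le mUe bUe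
  -- centred parts: measurable, bounded by 2B on D, even
  have mC₁ : Measurable fun a => E₁ a - m₁ := mE₁.sub measurable_const
  have mC₂ : Measurable fun a => E₂ a - m₂ := mE₂.sub measurable_const
  have mCu : Measurable fun a => Ue a - mu := mUe.sub measurable_const
  have bC₁ : ∀ a ∈ smallField H s, |E₁ a - m₁| ≤ 2 * B := fun a ha => by
    have := abs_sub _ _ |>.trans (add_le_add (bE₁ a ha) bm₁); linarith
  have bC₂ : ∀ a ∈ smallField H s, |E₂ a - m₂| ≤ 2 * B := fun a ha => by
    have := abs_sub _ _ |>.trans (add_le_add (bE₂ a ha) bm₂); linarith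
  have bCu : ∀ a ∈ smallField H s, |Ue a - mu| ≤ 2 * B := fun a ha => by
    have := abs_sub _ _ |>.trans (add_le_add (bUe a ha) bmu); linarith
  have pC₁ : ∀ a, E₁ (-a) - m₁ = E₁ a - m₁ := fun a => by rw [pE₁]
  have pC₂ : ∀ a, E₂ (-a) - m₂ = E₂ a - m₂ := fun a => by rw [pE₂]
  have pCu : ∀ a, Ue (-a) - mu = Ue a - mu := fun a => by rw [pUe]
  -- generic: a triple product of factors bounded by 2B on D is bounded by (2B)^3 on D
  have b2 : ∀ {F : (LandauFree H → E3) → ℝ}, (∀ a ∈ smallField H s, |F a| ≤ B) → ∀ a ∈ smallField H s, |F a| ≤ 2 * B :=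
    fun hF a ha => (hF a ha).trans (by linarith)
  have trip : ∀ {F G K : (LandauFree H → E3) → ℝ}, (∀ a ∈ smallField H s, |F a| ≤ 2 * B) → (∀ a ∈ smallField H s, |G a| ≤ 2 * B) →
      (∀ a ∈ smallField H s, |K a| ≤ 2 * B) → ∀ a ∈ smallField H s, |F a * G a * K a| ≤ (2 * B) ^ 3 := by
    intro F G K hF hG hK a ha
    rw [abs_mul, abs_mul]
    have h1 := hF a ha; have h2 := hG a ha; have h3 := hK a ha
    calc |F a| * |G a| * |K a| ≤ 2 * B * (2 * B) * (2 * B) :=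
          mul_le_mul (mul_le_mul h1 h2 (abs_nonneg _) (by linarith)) h3 (abs_nonneg _) (by positivity)
      _ = (2 * B) ^ 3 := by ring
  -- the eight products
  set P1 : (LandauFree H → E3) → ℝ := fun a => (E₁ a - m₁) * (E₂ a - m₂) * (Ue a - mu) with hP1
  set P2 : (LandauFree H → E3) → ℝ := fun a => (E₁ a - m₁) * (E₂ a - m₂) * Uo a with hP2
  set P3 : (LandauFree H → E3) → ℝ := fun a => (E₁ a - m₁) * O₂ a * (Ue a - mu) with hP3
  set P4 : (LandauFree H → E3) → ℝ := fun a => (E₁ a - m₁) * O₂ a * Uo a with hP4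
  set P5 : (LandauFree H → E3) → ℝ := fun a => O₁ a * (E₂ a - m₂) * (Ue a - mu) with hP5
  set P6 : (LandauFree H → E3) → ℝ := fun a => O₁ a * (E₂ a - m₂) * Uo a with hP6
  set P7 : (LandauFree H → E3) → ℝ := fun a => O₁ a * O₂ a * (Ue a - mu) with hP7
  set P8 : (LandauFree H → E3) → ℝ := fun a => O₁ a * O₂ a * Uo a with hP8
  -- the four vanishing terms
  have v2 : tiltExp μD U 0 P2 = 0 := tiltExp_muD_zero_even_even_odd H hβ s U pE₁ pE₂ pUo m₁ m₂
  have v3 : tiltExp μD U 0 P3 = 0 := tiltExp_muD_zero_even_odd_even H hβ s U pE₁ pO₂ pUe m₁ mu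
  have v5 : tiltExp μD U 0 P5 = 0 := tiltExp_muD_zero_odd_even_even H hβ s U pO₁ pE₂ pUe m₂ mu
  have v8 : tiltExp μD U 0 P8 = 0 := tiltExp_muD_zero_odd_odd_odd H hβ s U pO₁ pO₂ pUo
  have hB8 : 0 ≤ (2 * B) ^ 3 := by positivity
  -- bounds of the eight products on D
  have q1 : ∀ a ∈ smallField H s, |P1 a| ≤ (2 * B) ^ 3 := trip bC₁ bC₂ bCu
  have q2 : ∀ a ∈ smallField H s, |P2 a| ≤ (2 * B) ^ 3 := trip bC₁ bC₂ (b2 bUo)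
  have q3 : ∀ a ∈ smallField H s, |P3 a| ≤ (2 * B) ^ 3 := trip bC₁ (b2 bO₂) bCu
  have q4 : ∀ a ∈ smallField H s, |P4 a| ≤ (2 * B) ^ 3 := trip bC₁ (b2 bO₂) (b2 bUo)
  have q5 : ∀ a ∈ smallField H s, |P5 a| ≤ (2 * B) ^ 3 := trip (b2 bO₁) bC₂ bCu
  have q6 : ∀ a ∈ smallField H s, |P6 a| ≤ (2 * B) ^ 3 := trip (b2 bO₁) bC₂ (b2 bUo)
  have q7 : ∀ a ∈ smallField H s, |P7 a| ≤ (2 * B) ^ 3 := trip (b2 bO₁) (b2 bO₂) bCu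
  have q8 : ∀ a ∈ smallField H s, |P8 a| ≤ (2 * B) ^ 3 := trip (b2 bO₁) (b2 bO₂) (b2 bUo)
  -- measurability of the eight products
  have n1 : Measurable P1 := (mC₁.mul mC₂).mul mCu
  have n2 : Measurable P2 := (mC₁.mul mC₂).mul mUo
  have n3 : Measurable P3 := (mC₁.mul mO₂).mul mCu
  have n4 : Measurable P4 := (mC₁.mul mO₂).mul mUo
  have n5 : Measurable P5 := (mO₁.mul mC₂).mul mCu
  have n6 : Measurable P6 := (mO₁.mul mC₂).mul mUo
  have n7 : Measurable P7 := (mO₁.mul mO₂).mul mCu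
  have n8 : Measurable P8 := (mO₁.mul mO₂).mul mUo
  -- pairwise sums
  have add2 : ∀ {F G : (LandauFree H → E3) → ℝ} {C : ℝ}, (∀ a ∈ smallField H s, |F a| ≤ C) → (∀ a ∈ smallField H s, |G a| ≤ C) →
      ∀ a ∈ smallField H s, |F a + G a| ≤ 2 * C := fun hF hG a ha => (abs_add_le _ _).trans (by linarith [hF a ha, hG a ha])
  have q12 : ∀ a ∈ smallField H s, |P1 a + P2 a| ≤ 2 * (2 * B) ^ 3 := add2 q1 q2
  have q34 : ∀ a ∈ smallField H s, |P3 a + P4 a| ≤ 2 * (2 * B) ^ 3 := add2 q3 q4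
  have q56 : ∀ a ∈ smallField H s, |P5 a + P6 a| ≤ 2 * (2 * B) ^ 3 := add2 q5 q6
  have q78 : ∀ a ∈ smallField H s, |P7 a + P8 a| ≤ 2 * (2 * B) ^ 3 := add2 q7 q8
  have q1234 : ∀ a ∈ smallField H s, |(P1 a + P2 a) + (P3 a + P4 a)| ≤ 2 * (2 * (2 * B) ^ 3) := add2 q12 q34
  have q5678 : ∀ a ∈ smallField H s, |(P5 a + P6 a) + (P7 a + P8 a)| ≤ 2 * (2 * (2 * B) ^ 3) := add2 q56 q78
  have n12 : Measurable fun a => P1 a + P2 a := n1.add n2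
  have n34 : Measurable fun a => P3 a + P4 a := n3.add n4
  have n56 : Measurable fun a => P5 a + P6 a := n5.add n6
  have n78 : Measurable fun a => P7 a + P8 a := n7.add n8
  have n1234 : Measurable fun a => (P1 a + P2 a) + (P3 a + P4 a) := n12.add n34
  have n5678 : Measurable fun a => (P5 a + P6 a) + (P7 a + P8 a) := n56.add n78
  have s12 := tiltExp_muD_zero_add H hβ s U hB8 n1 n2 q1 q2
  have s34 := tiltExp_muD_zero_add H hβ s U hB8 n3 n4 q3 q4
  have s56 := tiltExp_muD_zero_add H hβ s U hB8 n5 n6 q5 q6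
  have s78 := tiltExp_muD_zero_add H hβ s U hB8 n7 n8 q7 q8
  have s1234 := tiltExp_muD_zero_add H hβ s U (by positivity : (0:ℝ) ≤ 2 * (2 * B) ^ 3) n12 n34 q12 q34
  have s5678 := tiltExp_muD_zero_add H hβ s U (by positivity : (0:ℝ) ≤ 2 * (2 * B) ^ 3) n56 n78 q56 q78
  have sAll := tiltExp_muD_zero_add H hβ s U (by positivity : (0:ℝ) ≤ 2 * (2 * (2 * B) ^ 3)) n1234 n5678 q1234 q5678
  -- the cumulant's integrand equals the sum of the eight products
  have hint : (fun a => ((fun a => E₁ a + O₁ a) a - tiltExp μD U 0 (fun a => E₁ a + O₁ a)) *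
      ((fun a => E₂ a + O₂ a) a - tiltExp μD U 0 (fun a => E₂ a + O₂ a)) * (U a - tiltExp μD U 0 U)) =
      fun a => ((P1 a + P2 a) + (P3 a + P4 a)) + ((P5 a + P6 a) + (P7 a + P8 a)) := by
    funext a
    simp only [hG₁, hG₂, hU, U, hP1, hP2, hP3, hP4, hP5, hP6, hP7, hP8]
    ring
  show tiltExp μD U 0 _ = _
  rw [hint, sAll, s1234, s5678, s12, s34, s56, s78, v2, v3, v5, v8]
  ring

end Tilt

end Summit.QuantumFields.YangMills.Theorems.AllWindowsColdBoxBoxHighLine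

end
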